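import Summits.Ventures.CertifiedManyBodySolver.Observables.PairLROOnePointWitnessLattice
import Summits.Ventures.CertifiedManyBodySolver.Observables.PairLROOnePointCeilingAux
import HarnessLib

/-!
# One-point witness, finite-volume steps: numerics of the KHvdL vector and the real-arithmetic step

HONEST FRAMING: first certified bounds on pairing observables; not a superconductivity verdict. Crew
hubbard-obs (D-0042), seat hubbard-obs-p1 (`prover-hubbard-obs-p1-g4-0`). Zero compute; no definition,
no named fact, no `sorry`. Steps of `PairLROOnePointCeiling.lean` (`liminf u_k ≤ 2M²` from a certified
one-point ceiling), kept separate so that each elaborates within the default budget: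

* `exists_onePointWitness_numerics` — for a unit sector ground state `ψ` with `a = ‖(P+Pᴴ)ψ‖₂ > 0` and
  bounds `Cg ≥ |Re⟨ψ,[P,Pᴴ]ψ⟩|`, `Cd ≥ ‖⟨ψ,[O,[H,O]]ψ⟩‖`: the KHvdL vector `Ξ` is a unit vector with
  `Re⟨Ξ,PΞ⟩ = a/2`, `Re⟨Ξ,HΞ⟩ ≤ E + Cd/(4a²)`, `|Re⟨Ξ,N_σΞ⟩ − N/2| ≤ Cg/(2a²)` (`σ = ↑,↓`);
* `onePoint_real_step` — the bookkeeping inequality collecting the `O(L⁻⁴)` corrections.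

References: T. Koma, H. Tasaki, J. Stat. Phys. 76 (1994) 745, §2.2 Theorem 2.2; T. A. Kaplan,
P. Horsch, W. von der Linden, J. Phys. Soc. Jpn. 58 (1989) 3894.
-/

noncomputable section

namespace Summit.Ventures.CertifiedManyBodySolver.Observables

open Matrix Complex Finset Literature.MathematicalPhysics.QuantumLattice Literature.Probability.LatticeModels
open Literature.MathematicalPhysics.QuantumLattice.HubbardWave0 ThermodynamicLimit Filter Topology
open Literature.MathematicalPhysics.QuantumManyBody.StateRelaxation
open scoped ComplexOrder ComplexConjugate BigOperators

/-! ### Finite-volume steps -/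

section Finite

variable {L : ℕ} [NeZero L] (g : Site 2 → ℝ)

/-- **Numerics of the one-point witness.** For a unit sector ground state `ψ` (sector `(N, S^z = 0)`) of
a Hermitian `H` with `a = ‖(P + Pᴴ)ψ‖₂ > 0`, and bounds `Cg ≥ |Re⟨ψ,[P,Pᴴ]ψ⟩|`,
`Cd ≥ ‖⟨ψ,[O,[H,O]]ψ⟩‖`, the KHvdL vector `Ξ` is a unit vector with `Re⟨Ξ,PΞ⟩ = a/2`,
`Re⟨Ξ,HΞ⟩ ≤ E + Cd/(4a²)` and spin fillings `|Re⟨Ξ,N_σΞ⟩ − N/2| ≤ Cg/(2a²)`.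
[cite: KomaTasaki1994, Theorem 2.2 (2.9)] [cite: KaplanHorschVonDerLinden1989] -/
theorem exists_onePointWitness_numerics
    {H : Matrix (Finset (Orb (FermionTorus 2 L))) (Finset (Orb (FermionTorus 2 L))) ℂ}
    (hH : H.IsHermitian) {N : ℕ} {ψ : Fock (Orb (FermionTorus 2 L))}
    (hψ1 : star ψ ⬝ᵥ ψ = 1) (hgs : IsGroundStateInSector H N 0 ψ)
    {av : ℝ} (hav : av = eucNorm ((pairField g L + (pairField g L)ᴴ) *ᵥ ψ)) (hav_pos : 0 < av)
    {Cg Cd : ℝ}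
    (hγ : |(expect (pairField g L * (pairField g L)ᴴ) ψ).re - (expect ((pairField g L)ᴴ * pairField g L) ψ).re| ≤ Cg)
    (hδ : ‖expect ((pairField g L + (pairField g L)ᴴ) * (H * (pairField g L + (pairField g L)ᴴ) -
            (pairField g L + (pairField g L)ᴴ) * H) -
          (H * (pairField g L + (pairField g L)ᴴ) - (pairField g L + (pairField g L)ᴴ) * H) *
            (pairField g L + (pairField g L)ᴴ)) ψ‖ ≤ Cd) :
    ∃ Ξ : Fock (Orb (FermionTorus 2 L)), star Ξ ⬝ᵥ Ξ = 1 ∧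
      (expect (pairField g L) Ξ).re = av / 2 ∧
      (star Ξ ⬝ᵥ (H *ᵥ Ξ)).re ≤ H.minEnergyOn (szSector N 0) + Cd / (4 * av ^ 2) ∧
      ∀ σ : Fin 2, |(star Ξ ⬝ᵥ ((∑ y : FermionTorus 2 L, numberOp y σ) *ᵥ Ξ)).re - (N : ℝ) / 2| ≤
        Cg / (2 * av ^ 2) := by
  have hφK := hgs.1
  have hw : (pairField g L + (pairField g L)ᴴ) *ᵥ ψ ≠ 0 := by
    intro h; rw [hav, h, eucNorm_zero] at hav_pos; exact lt_irrefl _ hav_pos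
  obtain ⟨-, Ξ, hΞ1, hΞP, -, -, hΞH, -, hΞX, -⟩ := exists_pairField_onePointWitness (g := g) hH hψ1 hgs hw
  rw [← hav] at hΞP hΞH
  have ha2c : star ((pairField g L + (pairField g L)ᴴ) *ᵥ ψ) ⬝ᵥ ((pairField g L + (pairField g L)ᴴ) *ᵥ ψ) =
      ((av ^ 2 : ℝ) : ℂ) := by
    rw [hav]; exact star_dotProduct_self_eq_eucNorm_sq _
  refine ⟨Ξ, hΞ1, hΞP, ?_, fun σ => ?_⟩
  · -- energy
    have e : (star Ξ ⬝ᵥ (H *ᵥ Ξ)).re = (expect H Ξ).re := rfl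
    rw [e, hΞH]
    have h := (Complex.re_le_norm _).trans hδ
    have : (expect ((pairField g L + (pairField g L)ᴴ) * (H * (pairField g L + (pairField g L)ᴴ) -
            (pairField g L + (pairField g L)ᴴ) * H) -
          (H * (pairField g L + (pairField g L)ᴴ) - (pairField g L + (pairField g L)ᴴ) * H) *
            (pairField g L + (pairField g L)ᴴ)) ψ).re / (4 * av ^ 2) ≤ Cd / (4 * av ^ 2) :=
      div_le_div_of_nonneg_right h (by positivity)
    linarith
  · -- spin fillings
    have hNσφ : (∑ y : FermionTorus 2 L, numberOp y σ) *ᵥ ψ = ((((N : ℝ) / 2 : ℝ)) : ℂ) • ψ :=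
      spinNumber_mulVec_of_mem_szSector σ hφK
    obtain ⟨-, t2, -, t4⟩ := onePointWitness_table (spinNumber_isHermitian σ)
      (spinNumber_commutator_pairField g σ) one_ne_zero hNσφ
    have h6 := hΞX (∑ y : FermionTorus 2 L, numberOp y σ) (spinNumber_mul_totalNumber_comm σ)
    rw [← hav] at h6
    set A' : ℂ := star ψ ⬝ᵥ (((pairField g L)ᴴ * pairField g L) *ᵥ ψ) with hA'
    set B' : ℂ := star ψ ⬝ᵥ ((pairField g L * (pairField g L)ᴴ) *ᵥ ψ) with hB'
    have hsumAB : A' + B' = ((av ^ 2 : ℝ) : ℂ) := by rw [← t2, ha2c]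
    have hEψ : star ψ ⬝ᵥ ((∑ y : FermionTorus 2 L, numberOp y σ) *ᵥ ψ) = ((((N : ℝ) / 2 : ℝ)) : ℂ) := by
      rw [hNσφ, dotProduct_smul, hψ1, smul_eq_mul, mul_one]
    have hav2ne : ((av ^ 2 : ℝ) : ℂ) ≠ 0 := by exact_mod_cast (pow_pos hav_pos 2).ne'
    have hC : star Ξ ⬝ᵥ ((∑ y : FermionTorus 2 L, numberOp y σ) *ᵥ Ξ) =
        ((((N : ℝ) / 2 : ℝ)) : ℂ) + (B' - A') / ((2 * av ^ 2 : ℝ) : ℂ) := by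
      have e1 : star Ξ ⬝ᵥ ((∑ y : FermionTorus 2 L, numberOp y σ) *ᵥ Ξ) =
          star ψ ⬝ᵥ ((∑ y : FermionTorus 2 L, numberOp y σ) *ᵥ ψ) / 2 +
            star ((pairField g L + (pairField g L)ᴴ) *ᵥ ψ) ⬝ᵥ
              ((∑ y : FermionTorus 2 L, numberOp y σ) *ᵥ ((pairField g L + (pairField g L)ᴴ) *ᵥ ψ)) /
              (2 * ((av ^ 2 : ℝ) : ℂ)) := h6
      rw [e1, hEψ, t4, hsumAB]
      push_cast
      field_simp
      ring
    have hre : (star Ξ ⬝ᵥ ((∑ y : FermionTorus 2 L, numberOp y σ) *ᵥ Ξ)).re =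
        (N : ℝ) / 2 + (B' - A').re / (2 * av ^ 2) := by
      rw [hC, Complex.add_re, Complex.ofReal_re, Complex.div_ofReal_re]
    have hBA : (B' - A').re = (expect (pairField g L * (pairField g L)ᴴ) ψ).re -
        (expect ((pairField g L)ᴴ * pairField g L) ψ).re := by
      rw [Complex.sub_re]; rfl
    rw [hre, add_sub_cancel_left, abs_div, abs_of_pos (by positivity : (0:ℝ) < 2 * av ^ 2), hBA]
    exact div_le_div_of_nonneg_right hγ (by positivity)

/-- The real-arithmetic step of the finite-volume argument (collecting the `O(L⁻⁴)` corrections of the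
witness into `K/L⁴`, `K = ((Σ|μ_σ|)Cγ/2 + κCδ/4)/c₀`). [folklore] -/
theorem onePoint_real_step {c A ν κ u E eΞ av Lr c₀ Cγ Cδ N2 : ℝ} (μ nσ : Fin 2 → ℝ)
    (hL : 0 < Lr) (hav_pos : 0 < av) (hc₀ : 0 < c₀) (hκ : 0 ≤ κ) (hCγ : 0 ≤ Cγ) (hCδ : 0 ≤ Cδ)
    (hav2 : 2 * c₀ * Lr ^ 4 - Cγ * Lr ^ 2 ≤ av ^ 2) (hav2' : c₀ * Lr ^ 4 ≤ av ^ 2)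
    (hn : ∀ σ, |nσ σ - N2| ≤ Cγ * Lr ^ 2 / (2 * av ^ 2))
    (he : eΞ ≤ E + Cδ * Lr ^ 2 / (4 * av ^ 2))
    (hwin : c - A + ∑ σ : Fin 2, μ σ * (nσ σ / Lr ^ 2 - ν) + κ * (u - eΞ / Lr ^ 2) ≤ -(av / 2) / Lr ^ 2) :
    Real.sqrt (2 * c₀ - Cγ / Lr ^ 2) / 2 ≤
      -(c - A + (∑ σ : Fin 2, μ σ) * (N2 / Lr ^ 2 - ν) + κ * (u - E / Lr ^ 2)) +
        (((∑ σ : Fin 2, |μ σ|) * Cγ / 2 + κ * Cδ / 4) / c₀) / Lr ^ 4 := by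
  have hL2pos : 0 < Lr ^ 2 := by positivity
  have hL4pos : 0 < Lr ^ 4 := by positivity
  have hav2pos : 0 < av ^ 2 := by positivity
  -- filling rows: `Σ μ_σ (n_σ/L² − ν) ≥ (Σ μ_σ)(N2/L² − ν) − (Σ|μ_σ|)(Cγ/2)/a²`
  have hper : ∀ σ : Fin 2, μ σ * (N2 / Lr ^ 2 - ν) - |μ σ| * (Cγ / 2 / av ^ 2) ≤ μ σ * (nσ σ / Lr ^ 2 - ν) := by
    intro σ
    have hq : |(nσ σ - N2) / Lr ^ 2| ≤ Cγ / 2 / av ^ 2 := by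
      rw [abs_div, abs_of_pos hL2pos, div_le_iff₀ hL2pos]
      calc |nσ σ - N2| ≤ Cγ * Lr ^ 2 / (2 * av ^ 2) := hn σ
        _ = Cγ / 2 / av ^ 2 * Lr ^ 2 := by field_simp
    have hb := (abs_mul (μ σ) ((nσ σ - N2) / Lr ^ 2)).symm ▸ mul_le_mul_of_nonneg_left hq (abs_nonneg (μ σ))
    have hb' := (abs_le.1 hb).1
    have key : μ σ * (nσ σ / Lr ^ 2 - ν) = μ σ * (N2 / Lr ^ 2 - ν) + μ σ * ((nσ σ - N2) / Lr ^ 2) := by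
      field_simp
      ring
    rw [key]
    linarith
  have hfill : (∑ σ : Fin 2, μ σ) * (N2 / Lr ^ 2 - ν) - (∑ σ : Fin 2, |μ σ|) * (Cγ / 2 / av ^ 2) ≤
      ∑ σ : Fin 2, μ σ * (nσ σ / Lr ^ 2 - ν) := by
    have h := Finset.sum_le_sum fun σ (_ : σ ∈ (Finset.univ : Finset (Fin 2))) => hper σ
    rwa [Finset.sum_sub_distrib, ← Finset.sum_mul, ← Finset.sum_mul] at h
  -- energy row
  have henergy : κ * (u - E / Lr ^ 2) - κ * (Cδ / 4 / av ^ 2) ≤ κ * (u - eΞ / Lr ^ 2) := by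
    have h1 : eΞ / Lr ^ 2 ≤ E / Lr ^ 2 + Cδ / 4 / av ^ 2 := by
      have h := div_le_div_of_nonneg_right he hL2pos.le
      have e : (E + Cδ * Lr ^ 2 / (4 * av ^ 2)) / Lr ^ 2 = E / Lr ^ 2 + Cδ / 4 / av ^ 2 := by
        field_simp
      linarith [h, e.le, e.ge]
    nlinarith [mul_le_mul_of_nonneg_left h1 hκ]
  -- the two corrections together are `≤ K/L⁴`
  have hKL : (∑ σ : Fin 2, |μ σ|) * (Cγ / 2 / av ^ 2) + κ * (Cδ / 4 / av ^ 2) ≤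
      (((∑ σ : Fin 2, |μ σ|) * Cγ / 2 + κ * Cδ / 4) / c₀) / Lr ^ 4 := by
    have hnum : 0 ≤ (∑ σ : Fin 2, |μ σ|) * Cγ / 2 + κ * Cδ / 4 := by positivity
    have e1 : (∑ σ : Fin 2, |μ σ|) * (Cγ / 2 / av ^ 2) + κ * (Cδ / 4 / av ^ 2) =
        ((∑ σ : Fin 2, |μ σ|) * Cγ / 2 + κ * Cδ / 4) / av ^ 2 := by
      field_simp
    have e2 : (((∑ σ : Fin 2, |μ σ|) * Cγ / 2 + κ * Cδ / 4) / c₀) / Lr ^ 4 =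
        ((∑ σ : Fin 2, |μ σ|) * Cγ / 2 + κ * Cδ / 4) / (c₀ * Lr ^ 4) := by
      rw [div_div]
    rw [e1, e2]
    exact div_le_div_of_nonneg_left hnum (by positivity) hav2'
  -- the one-point side: `√(2c₀ − Cγ/L²)/2 ≤ a/(2L²)`
  have hs_le : Real.sqrt (2 * c₀ - Cγ / Lr ^ 2) / 2 ≤ av / 2 / Lr ^ 2 := by
    have hroot : Real.sqrt (2 * c₀ - Cγ / Lr ^ 2) * Lr ^ 2 ≤ av := by
      have e1 : Real.sqrt (2 * c₀ - Cγ / Lr ^ 2) * Lr ^ 2 =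
          Real.sqrt ((2 * c₀ - Cγ / Lr ^ 2) * (Lr ^ 2) ^ 2) := by
        rw [Real.sqrt_mul' _ (by positivity), Real.sqrt_sq hL2pos.le]
      have e2 : (2 * c₀ - Cγ / Lr ^ 2) * (Lr ^ 2) ^ 2 = 2 * c₀ * Lr ^ 4 - Cγ * Lr ^ 2 := by
        field_simp
      rw [e1, e2, ← Real.sqrt_sq hav_pos.le]
      exact Real.sqrt_le_sqrt hav2
    rw [div_div, div_le_div_iff₀ (by norm_num : (0:ℝ) < 2) (by positivity)]
    nlinarith [hroot, hL2pos]
  have hw' : -(av / 2) / Lr ^ 2 = -(av / 2 / Lr ^ 2) := by ring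
  rw [hw'] at hwin
  linarith [hwin, hfill, henergy, hKL, hs_le]

end Finite

end Summit.Ventures.CertifiedManyBodySolver.Observables

end
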